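import Summits.ResolutionOfSingularities.ResolutionOfSingularities.Theorems.FrobeniusLadderFInjectiveMacaulayficationX2Cubic4Specimen
import Summits.ResolutionOfSingularities.ResolutionOfSingularities.Theorems.FrobeniusLadderFInjectiveMacaulayficationPointFloorLegalOfIsolated
import HarnessLib

/-!
# THE POINT FLOOR OF THE (RR-I2) BED `x² + y³ + u³ + t³ + s³` (ANY `p ∉ {2,3}`): the five strict transforms, LEGALITY for EVERY blowing up, and the singular locus ⊇ the Fermat-cubic surface
# (crux `FInjectiveMacaulayfication` stmt-ResolutionOfSingularities-15315, chain w45a; res-L1-w45a-plan-1 RULING R21.29 (1) «GO, input side only»; bed memo `Lines/RR-I2-bed-x2y3u3t3s3.md`;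
# ONE application of res-L1-w45a-stub-3's generic ✓p651649 `PointFloorLegalOfIsolated.pointFloor_input_legal`; seat res-L1-w45a-lead-1 g10)

[OURS · L1 W4.5a] Support file (`--supports stmt-ResolutionOfSingularities-15315 --as helper`); def-free; UNCONDITIONAL. Replaces the role of NO printed item; NOT a statement of the
manuscript; AI-written (AI review is weaker than expert review).

WHAT. `Y = Spec k[X]/(f)`, `f = X4² + X0³ + X1³ + X2³ + X3³` (`X 0..3 = y,u,t,s`, `X 4 = x`), `v` = the origin, `I := 𝔪̃|_{Spec 𝒪_{Y,v}}` — the POINT FLOOR, a T″-side input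
(the vertex is FULL for `p ∉ {2,3}` — NOT proved here). The five Rees charts of `Bl_𝔪 Y` are the hypersurfaces `k[X]/(gᵢ)`, `θᵢ f = Xᵢ²·gᵢ`:
`g_y = x² + y·(1 + u³ + t³ + s³)`, `g_u`, `g_t`, `g_s` symmetric, `g_x = 1 + x·(y³ + u³ + t³ + s³)` (letters renamed back).
* §1 `theta`, `g_not_mem_span_X`;
* §2 ★★ `pointFloor_x2cubic4_input_legal` — for EVERY blowing up `g : S′ → Spec 𝒪_{Y,v}` along `I`: `I ≠ ⊥` ∧ `Supp I ⊆ (Reg)ᶜ` ∧ `S′` regular off the closed fibre ∧ `S′` CM at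
  every stalk (needs `2, 3 ≠ 0` in `k`);
* §3 ★ THE SINGULAR LOCUS OF THE `y`-CHART CONTAINS THE FERMAT-CUBIC SURFACE: `not_isRegularLocalRing_of_mem_sq` (generic: a hypersurface `k[X]/(g)` is NOT regular at a prime `P`
  with `g ∈ (P′)²`, `P′` the preimage — the tree's Jacobian lemma without the rational point) and ★ `yChart_not_regular_of_le : (x̄, ȳ, w̄) ≤ P → ¬ IsRegularLocalRing (k[X]/(g_y))_P`,
  `w = 1 + u³ + t³ + s³` (`g_y = x·x + y·w ∈ (P′)²`) — every point of `Σ_y = V(x, y, w)` (the affine Fermat cubic surface inside the exceptional divisor) is a SINGULAR point of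
  the floor, in every characteristic.
NOT here (stub-sized, R21.29 (1)(b)): the converse inclusion (regular off `Σ`), FULLness of the floor along `Σ` (non-monomial Fedder cell `(y·w)^{p−1}`), `Bl_Σ` regular
(non-coordinate centre), the `TStepInstanceAt` assembly.
[folklore assembly; cite: GortzWedhorn2020, Prop. 13.91 (2), (13.19)] [cite: StacksProject, Tag 0804; Tag 02OS; Tag 01J7] [cite: Temkin2008, §2.1] [cite: Matsumura1987, Thm. 14.2 (context)]
[cite: Kollar2007, §2.5 (strict transforms under point blow-ups)]
-/

-- single-problem summit: the doubled namespace component is forced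
set_option linter.dupNamespace false

noncomputable section

namespace Summit.ResolutionOfSingularities.ResolutionOfSingularities.Theorems.FInjectiveMacaulayfication.X2Cubic4PointFloor

open CategoryTheory CategoryTheory.Limits AlgebraicGeometry TopologicalSpace IsLocalRing MvPolynomial
open Literature.AlgebraicGeometry.Resolution
open Summit.ResolutionOfSingularities.ResolutionOfSingularities.Theorems.FInjectiveMacaulayfication
open SliceableCentre GermOfGlobalBlowup

variable (k : Type) [Field k]

/-! ## §1 The strict transforms -/

/-- ★ **The chart identities** `θᵢ f = Xᵢ² · gᵢ` for the point blow-up substitutions `θᵢ : Xⱼ ↦ XⱼXᵢ (j ≠ i), Xᵢ ↦ Xᵢ`. [folklore] -/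
theorem theta (f : MvPolynomial (Fin 5) k) (hf : f = X 4 ^ 2 + X 0 ^ 3 + X 1 ^ 3 + X 2 ^ 3 + X 3 ^ 3) :
    ∀ i : Fin 5, aeval (fun j : Fin 5 => if j = i then (X i : MvPolynomial (Fin 5) k) else X j * X i) f =
      X i ^ ((fun _ : Fin 5 => 2) i) * (![X 4 ^ 2 + X 0 + X 0 * X 1 ^ 3 + X 0 * X 2 ^ 3 + X 0 * X 3 ^ 3,
        X 4 ^ 2 + X 1 * X 0 ^ 3 + X 1 + X 1 * X 2 ^ 3 + X 1 * X 3 ^ 3,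
        X 4 ^ 2 + X 2 * X 0 ^ 3 + X 2 * X 1 ^ 3 + X 2 + X 2 * X 3 ^ 3,
        X 4 ^ 2 + X 3 * X 0 ^ 3 + X 3 * X 1 ^ 3 + X 3 * X 2 ^ 3 + X 3,
        1 + X 4 * X 0 ^ 3 + X 4 * X 1 ^ 3 + X 4 * X 2 ^ 3 + X 4 * X 3 ^ 3] : Fin 5 → MvPolynomial (Fin 5) k) i := by
  intro i
  subst hf
  fin_cases i <;> simp <;> ring

/-- `gᵢ ∉ (Xᵢ)` for every `i`: evaluate at `e_x` (`gᵢ = 1` there, `i ≤ 3`) resp. at `0` (`g_x(0) = 1`). [folklore] -/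
theorem g_not_mem_span_X :
    ∀ i : Fin 5, (![X 4 ^ 2 + X 0 + X 0 * X 1 ^ 3 + X 0 * X 2 ^ 3 + X 0 * X 3 ^ 3,
        X 4 ^ 2 + X 1 * X 0 ^ 3 + X 1 + X 1 * X 2 ^ 3 + X 1 * X 3 ^ 3,
        X 4 ^ 2 + X 2 * X 0 ^ 3 + X 2 * X 1 ^ 3 + X 2 + X 2 * X 3 ^ 3,
        X 4 ^ 2 + X 3 * X 0 ^ 3 + X 3 * X 1 ^ 3 + X 3 * X 2 ^ 3 + X 3,
        1 + X 4 * X 0 ^ 3 + X 4 * X 1 ^ 3 + X 4 * X 2 ^ 3 + X 4 * X 3 ^ 3] : Fin 5 → MvPolynomial (Fin 5) k) i ∉ Ideal.span {(X i : MvPolynomial (Fin 5) k)} := by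
  intro i h
  rw [Ideal.mem_span_singleton] at h
  obtain ⟨c, hc⟩ := h
  fin_cases i
  · have := congrArg (MvPolynomial.eval (Pi.single 4 1 : Fin 5 → k)) hc; simp at this
  · have := congrArg (MvPolynomial.eval (Pi.single 4 1 : Fin 5 → k)) hc; simp at this
  · have := congrArg (MvPolynomial.eval (Pi.single 4 1 : Fin 5 → k)) hc; simp at this
  · have := congrArg (MvPolynomial.eval (Pi.single 4 1 : Fin 5 → k)) hc; simp at this
  · have := congrArg (MvPolynomial.eval (0 : Fin 5 → k)) hc; simp at this

/-! ## §2 For EVERY blowing up along the point floor: legal -/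

/-- ★★ **THE POINT FLOOR OF THE BED IS A LEGAL INPUT** (of T″ / `RegTowerTerminates` / the F-half alike): for every blowing up `g : S′ → Spec 𝒪_{Y,v}` along `I = 𝔪̃|_{Spec 𝒪_{Y,v}}`:
(1) `I ≠ ⊥`; (2) `Supp I ⊆ (Reg Spec 𝒪_{Y,v})ᶜ`; (3) `S′` is regular off the closed fibre; (4) `S′` satisfies the CM clause at every point — ONE application of the generic
`PointFloorLegalOfIsolated.pointFloor_input_legal` (any characteristic with `2, 3` units). [folklore assembly; cite: GortzWedhorn2020, Prop. 13.91 (2)] [cite: StacksProject, Tag 02OS; Tag 01J7]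
[cite: Temkin2008, §2.1] -/
theorem pointFloor_x2cubic4_input_legal (h2 : (2 : k) ≠ 0) (h3 : (3 : k) ≠ 0) (f : MvPolynomial (Fin 5) k) (hf : f = X 4 ^ 2 + X 0 ^ 3 + X 1 ^ 3 + X 2 ^ 3 + X 3 ^ 3)
    (v : Spec (.of (MvPolynomial (Fin 5) k ⧸ Ideal.span {f})))
    (hv : v.asIdeal = Ideal.span (Set.range (fun j : Fin 5 => Ideal.Quotient.mk (Ideal.span {f}) (X j))))
    (S' : Scheme.{0}) (g : S' ⟶ Spec ((Spec (.of (MvPolynomial (Fin 5) k ⧸ Ideal.span {f}))).presheaf.stalk v))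
    (hg : IsBlowup g ((affineBlowup.idealSheaf (Ideal.span (Set.range (fun j : Fin 5 => Ideal.Quotient.mk (Ideal.span {f}) (X j))))).comap ((Spec (.of (MvPolynomial (Fin 5) k ⧸ Ideal.span {f}))).fromSpecStalk v))) :
    ((affineBlowup.idealSheaf (Ideal.span (Set.range (fun j : Fin 5 => Ideal.Quotient.mk (Ideal.span {f}) (X j))))).comap ((Spec (.of (MvPolynomial (Fin 5) k ⧸ Ideal.span {f}))).fromSpecStalk v)) ≠ ⊥ ∧
    (((((affineBlowup.idealSheaf (Ideal.span (Set.range (fun j : Fin 5 => Ideal.Quotient.mk (Ideal.span {f}) (X j))))).comap ((Spec (.of (MvPolynomial (Fin 5) k ⧸ Ideal.span {f}))).fromSpecStalk v))).support : Set (Spec ((Spec (.of (MvPolynomial (Fin 5) k ⧸ Ideal.span {f}))).presheaf.stalk v))) ⊆ (Scheme.regularLocus (Spec ((Spec (.of (MvPolynomial (Fin 5) k ⧸ Ideal.span {f}))).presheaf.stalk v)))ᶜ) ∧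
    (∀ s : S', g.base s ≠ closedPoint ((Spec (.of (MvPolynomial (Fin 5) k ⧸ Ideal.span {f}))).presheaf.stalk v) → s ∈ Scheme.regularLocus S') ∧
    (∀ s : S', CMCl (S'.presheaf.stalk s)) :=
  PointFloorLegalOfIsolated.pointFloor_input_legal k f (X2Cubic4Specimen.prime_f k h3 f hf) (by norm_num) (fun _ : Fin 5 => 2) _ (theta k f hf)
    (X2Cubic4Specimen.f_not_mem_span_X k f hf) (g_not_mem_span_X k) v hv (X2Cubic4Specimen.vertex_not_mem_regularLocus k h3 f hf v hv)
    (X2Cubic4Specimen.regular_of_ne_vertex k h2 h3 f hf v hv) S' g hg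

/-! ## §3 ★ The singular locus of the `y`-chart contains the Fermat-cubic surface `V(x, y, w)` -/

/-- **A hypersurface is NOT regular at a prime whose preimage contains the equation in its SQUARE** (the tree's Jacobian lemma
`not_isRegularLocalRing_localization_of_pderiv_eval_eq_zero` without a rational point: `(k[X]/(g))_P ≅ k[X]_{P′}/(g)` with `0 ≠ g ∈ (P′ k[X]_{P′})²`). [folklore; cite: Matsumura1987, Thm. 14.2] -/
theorem not_isRegularLocalRing_of_mem_sq {n : ℕ} (g : MvPolynomial (Fin n) k) (hg0 : g ≠ 0)
    (P : Ideal (MvPolynomial (Fin n) k ⧸ Ideal.span {g})) [P.IsPrime]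
    (hmem : g ∈ (P.comap (Ideal.Quotient.mk (Ideal.span {g}))) ^ 2) :
    ¬ IsRegularLocalRing (Localization.AtPrime P) := by
  intro hreg
  set Q : Ideal (MvPolynomial (Fin n) k) := P.comap (Ideal.Quotient.mk (Ideal.span {g})) with hQ
  haveI : Q.IsPrime := Ideal.comap_isPrime _ P
  have hgm2 : algebraMap (MvPolynomial (Fin n) k) (Localization.AtPrime Q) g ∈ maximalIdeal (Localization.AtPrime Q) ^ 2 := by
    rw [← Localization.AtPrime.map_eq_maximalIdeal, ← Ideal.map_pow]
    exact Ideal.mem_map_of_mem _ hmem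
  have hg0' : algebraMap (MvPolynomial (Fin n) k) (Localization.AtPrime Q) g ≠ 0 := by
    intro h
    obtain ⟨⟨c, hc⟩, hcg⟩ := (IsLocalization.map_eq_zero_iff Q.primeCompl (Localization.AtPrime Q) g).mp h
    rcases mul_eq_zero.mp hcg with h' | h'
    · have hc0 : c = 0 := h'
      exact hc (hc0 ▸ Q.zero_mem)
    · exact hg0 h'
  exact not_isRegularLocalRing_quotient_span_singleton_of_mem_sq hg0' hgm2 (isRegularLocalRing_localization_quotient_span_singleton g P)

/-- ★ **EVERY POINT OF `Σ_y = V(x̄, ȳ, w̄)` IS A SINGULAR POINT OF THE `y`-CHART `k[X]/(g_y)`**, `g_y = x² + y·w`, `w = 1 + u³ + t³ + s³`: for every prime `P ⊇ (x̄, ȳ, w̄)`,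
`g_y = x·x + y·w ∈ (P′)²`, so `(k[X]/(g_y))_P` is not regular — in EVERY characteristic (the transversal type along `Σ_y` is the A₁ surface point `x² + yw`). The converse
inclusion and FULLness along `Σ_y` are NOT claimed here. [OURS · certificate; cite: Matsumura1987, Thm. 14.2] -/
theorem yChart_not_regular_of_le (g₀ : MvPolynomial (Fin 5) k) (hg₀ : g₀ = X 4 ^ 2 + X 0 + X 0 * X 1 ^ 3 + X 0 * X 2 ^ 3 + X 0 * X 3 ^ 3)
    (P : Ideal (MvPolynomial (Fin 5) k ⧸ Ideal.span {g₀})) [P.IsPrime]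
    (hx : Ideal.Quotient.mk (Ideal.span {g₀}) (X 4) ∈ P) (hy : Ideal.Quotient.mk (Ideal.span {g₀}) (X 0) ∈ P)
    (hw : Ideal.Quotient.mk (Ideal.span {g₀}) (1 + X 1 ^ 3 + X 2 ^ 3 + X 3 ^ 3) ∈ P) :
    ¬ IsRegularLocalRing (Localization.AtPrime P) := by
  have hg0 : g₀ ≠ 0 := by
    intro h0
    have := congrArg (MvPolynomial.eval (Pi.single 4 1 : Fin 5 → k)) h0
    rw [hg₀] at this
    simp at this
  refine not_isRegularLocalRing_of_mem_sq k g₀ hg0 P ?_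
  have hx' : (X 4 : MvPolynomial (Fin 5) k) ∈ P.comap (Ideal.Quotient.mk (Ideal.span {g₀})) := hx
  have hy' : (X 0 : MvPolynomial (Fin 5) k) ∈ P.comap (Ideal.Quotient.mk (Ideal.span {g₀})) := hy
  have hw' : (1 + X 1 ^ 3 + X 2 ^ 3 + X 3 ^ 3 : MvPolynomial (Fin 5) k) ∈ P.comap (Ideal.Quotient.mk (Ideal.span {g₀})) := hw
  have hmem : (X 4 * X 4 + X 0 * (1 + X 1 ^ 3 + X 2 ^ 3 + X 3 ^ 3) : MvPolynomial (Fin 5) k) ∈ (P.comap (Ideal.Quotient.mk (Ideal.span {g₀}))) ^ 2 := by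
    rw [pow_two]
    exact Ideal.add_mem _ (Ideal.mul_mem_mul hx' hx') (Ideal.mul_mem_mul hy' hw')
  have e : (X 4 * X 4 + X 0 * (1 + X 1 ^ 3 + X 2 ^ 3 + X 3 ^ 3) : MvPolynomial (Fin 5) k) = g₀ := by rw [hg₀]; ring
  exact e ▸ hmem

/-- The same for a point of `Spec k[X]/(g_y)`: membership of `x̄, ȳ, w̄` in `P.asIdeal` ⇒ `P ∉ Reg`. [OURS · corollary] -/
theorem yChart_not_mem_regularLocus_of_le (g₀ : MvPolynomial (Fin 5) k) (hg₀ : g₀ = X 4 ^ 2 + X 0 + X 0 * X 1 ^ 3 + X 0 * X 2 ^ 3 + X 0 * X 3 ^ 3)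
    (P : Spec (.of (MvPolynomial (Fin 5) k ⧸ Ideal.span {g₀})))
    (hx : Ideal.Quotient.mk (Ideal.span {g₀}) (X 4) ∈ P.asIdeal) (hy : Ideal.Quotient.mk (Ideal.span {g₀}) (X 0) ∈ P.asIdeal)
    (hw : Ideal.Quotient.mk (Ideal.span {g₀}) (1 + X 1 ^ 3 + X 2 ^ 3 + X 3 ^ 3) ∈ P.asIdeal) :
    P ∉ Scheme.regularLocus (Spec (.of (MvPolynomial (Fin 5) k ⧸ Ideal.span {g₀}))) :=
  not_mem_regularLocus_Spec_of_not_isRegularLocalRing P (yChart_not_regular_of_le k g₀ hg₀ P.asIdeal hx hy hw)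

end Summit.ResolutionOfSingularities.ResolutionOfSingularities.Theorems.FInjectiveMacaulayfication.X2Cubic4PointFloor

end
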